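import Literature.NumberTheory.Transcendental.PhilipponZeroEstimateOrder
import Mathlib.LinearAlgebra.Finsupp.LinearCombination
import Mathlib.Algebra.MvPolynomial.PDeriv
import Mathlib.Algebra.BigOperators.Field
import HarnessLib

/-!
# Gen-3 engines ⇒ the zero estimate: from the engine's derivative identities at the points
# `θ^x` to `GaGm.VanishesToOrder` along the Baker–Wüstholz subspace (Nesterenko 2003, §5, (5.2)–(5.4))

`Summits/ABC/StewartYu/GenThreeVanishing.lean` — cell `abc-stewartyu` (rung F-A1 = Stewart–Yu 2001,
route `PadicPrimesKummerThird`, cruxes `Y07Odd` stmt-ABC-19658 / `Y07Two` stmt-ABC-19659), seat p3 (g4).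
Theorems only.

Every Gen-3 engine of the route (odd `p`, `p = 2`, and the archimedean model alike) ends its
extrapolation with identities of the shape (Nesterenko 2003, (5.2)/(5.4))
`∂₀^{m₀} ∂₁^{m₁} ⋯ ∂_{n-1}^{m_{n-1}} P (x, ξ₁^x, …, ξₙ^x) = 0` for all integers `|x| ≤ X'` and all
`m₀ + ⋯ + m_{n-1} ≤ T`, where `∂₀ = ∂/∂Y₀` and `∂ₖ = bₙ Yₖ ∂/∂Yₖ − bₖ Yₙ ∂/∂Yₙ` are the Baker–Wüstholz
invariant derivations (loc. cit. p. 72), and must then INVOKE the zero estimate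
`Literature.NumberTheory.Transcendental.Nesterenko2003_prop51`, whose hypothesis is
`∀ g ∈ GaGm.sumset Σ (n+1), GaGm.VanishesToOrder P 𝔚 g ((n+1)S₀ + 1)` — vanishing of ALL words of
invariant derivations `𝔇_{w₁} ⋯ 𝔇_{w_s}`, `wᵢ ∈ 𝔚 = {(η₀, η) : b₁η₁ + ⋯ + bₙηₙ = 0}`, `s ≤ (n+1)S₀`, at
the points of `Σ[n+1]` ("thanks to (5.4) … the polynomial `P` satisfies the conditions of
Proposition 5.1", loc. cit. p. 99).  This file proves that step once and for all, place-free: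

* §A (generic `GaGm m`): words of invariant derivations are multilinear in their letters, so the
  vanishing of all INDEX-words in a finite family `w : Fin d → Lie G` spanning `W` gives
  `GaGm.VanishesToOrder` along `W` (`vanishesToOrder_of_indexWords`; no commutativity is used);
* §B (the Baker–Wüstholz letters on `G = 𝔾ₐ × 𝔾ₘ^m` with a pivot coordinate `j₀`, `b_{j₀} ≠ 0`):
  the letters `e₀ = (1, 0)` and `(0, b_{j₀} e_k − b_k e_{j₀})` span every `W` on which `∑ bⱼ ηⱼ = 0`
  (`le_span_bwLetters`), act on monomials by `∂/∂Y₀` resp. by the scalar `b_{j₀} κ_{k+1} − b_k κ_{j₀+1}`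
  (`invDeriv_bwLetter_monomial`), and index-words act in closed form (`wordDeriv_bwLetters_monomial`);
* §C–§D (points `θ^x`, sumsets, and the HEADLINE `vanishesToOrder_sumset_of_engineIdentities` with its
  `Nesterenko2003_prop51`-shaped twin) are in the companion file `GenThreeVanishingPoints.lean`.

WHAT THIS IS NOT: not the zero estimate (p5, `Nesterenko2003_prop51_holds`), not its consumer
(p4, `NesterenkoZeroEnd`: the Matveev alternative after Prop. 5.1), not an engine.

References: Yu. V. Nesterenko, *Linear forms in logarithms of rational numbers*, LNM 1819 (2003),
§3.5 p. 72 (the operators `∂ₖ`), §5 pp. 89–90 ((5.2)–(5.4)), §5.1–5.2 pp. 91–92;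
D. Roy in LNM 1752, Ch. 11, Prop. 3.6 (iii) (the dictionary, tree file `PhilipponZeroEstimateOrder`).
-/

noncomputable section

open MvPolynomial Finset
open Literature.NumberTheory.Transcendental
open Literature.NumberTheory.Transcendental.GaGm

namespace Summit.ABC.StewartYu.GenThreeVanishing

/-! ## §A. Generic: index-words in a spanning family control the order of vanishing -/

section Generic

variable {m : ℕ}

/-- `D_0 = 0`. [folklore] -/
theorem invDeriv_zero_vec : invDeriv (m := m) (0 : ℂ × (Fin m → ℂ)) = 0 := by
  have h := invDeriv_smul (m := m) (0 : ℂ) (0 : ℂ × (Fin m → ℂ))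
  simpa using h

/-- Linearity of `u ↦ D_u` over finite linear combinations:
`D_{∑ cᵢ wᵢ} P = ∑ cᵢ D_{wᵢ} P`. [folklore] -/
theorem invDeriv_sum_smul_apply {ι : Type*} (s : Finset ι) (c : ι → ℂ)
    (w : ι → ℂ × (Fin m → ℂ)) (P : MvPolynomial (Fin (m + 1)) ℂ) :
    invDeriv (∑ i ∈ s, c i • w i) P = ∑ i ∈ s, c i • invDeriv (w i) P := by
  classical
  induction s using Finset.induction_on with
  | empty => simp [invDeriv_zero_vec]
  | insert a s ha ih =>
    rw [Finset.sum_insert ha, Finset.sum_insert ha, invDeriv_add, Derivation.add_apply,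
      invDeriv_smul, Derivation.smul_apply, ih]

/-- Words are homogeneous in the polynomial. [folklore] -/
theorem wordDeriv_smul {k : ℕ} (u : Fin k → ℂ × (Fin m → ℂ)) (c : ℂ)
    (Q : MvPolynomial (Fin (m + 1)) ℂ) : wordDeriv u (c • Q) = c • wordDeriv u Q := by
  induction k generalizing Q with
  | zero => rfl
  | succ k ih => rw [wordDeriv_succ, wordDeriv_succ, Derivation.map_smul, ih]

/-- Words are additive over finite sums in the polynomial. [folklore] -/
theorem wordDeriv_sum {k : ℕ} (u : Fin k → ℂ × (Fin m → ℂ)) {ι : Type*} (s : Finset ι)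
    (Q : ι → MvPolynomial (Fin (m + 1)) ℂ) :
    wordDeriv u (∑ i ∈ s, Q i) = ∑ i ∈ s, wordDeriv u (Q i) := by
  classical
  induction s using Finset.induction_on with
  | empty => simp
  | insert a s ha ih => rw [Finset.sum_insert ha, Finset.sum_insert ha, wordDeriv_add, ih]

/-- Appending a letter at the end of a word: `wordDeriv (v, e) P = wordDeriv v (D_e P)` (the last
letter acts first). [folklore] -/
theorem wordDeriv_snoc {k : ℕ} (v : Fin k → ℂ × (Fin m → ℂ)) (e : ℂ × (Fin m → ℂ))
    (Q : MvPolynomial (Fin (m + 1)) ℂ) :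
    wordDeriv (Fin.snoc v e : Fin (k + 1) → ℂ × (Fin m → ℂ)) Q = wordDeriv v (invDeriv e Q) := by
  rw [wordDeriv_succ, Fin.init_snoc, Fin.snoc_last]

/-- `evalAt` is additive over finite sums. [folklore] -/
theorem evalAt_sum {ι : Type*} (s : Finset ι) (Q : ι → MvPolynomial (Fin (m + 1)) ℂ) (g : GaGm m) :
    evalAt (∑ i ∈ s, Q i) g = ∑ i ∈ s, evalAt (Q i) g := by
  simp [evalAt, map_sum]

/-- `evalAt` is homogeneous. [folklore] -/
theorem evalAt_smul (c : ℂ) (Q : MvPolynomial (Fin (m + 1)) ℂ) (g : GaGm m) :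
    evalAt (c • Q) g = c * evalAt Q g := by
  simp [evalAt, smul_eval]

/-- HEREDITY of the index-word hypothesis under one more derivation in the span: if all index-words
of length `< R + 1` in the letters `w` kill `Q` at `g`, and `u ∈ span(w)`, then all index-words of
length `< R` kill `D_u Q` at `g`. [folklore] -/
theorem indexWords_invDeriv {d : ℕ} (w : Fin d → ℂ × (Fin m → ℂ))
    (Q : MvPolynomial (Fin (m + 1)) ℂ) (g : GaGm m) (R : ℕ)
    (hQ : ∀ j < R + 1, ∀ σ : Fin j → Fin d, evalAt (wordDeriv (w ∘ σ) Q) g = 0)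
    {u : ℂ × (Fin m → ℂ)} (hu : u ∈ Submodule.span ℂ (Set.range w)) :
    ∀ j < R, ∀ σ : Fin j → Fin d, evalAt (wordDeriv (w ∘ σ) (invDeriv u Q)) g = 0 := by
  classical
  obtain ⟨c, rfl⟩ := (Submodule.mem_span_range_iff_exists_fun ℂ).mp hu
  intro j hj σ
  rw [invDeriv_sum_smul_apply, wordDeriv_sum, evalAt_sum]
  refine Finset.sum_eq_zero fun i _ => ?_
  rw [wordDeriv_smul, evalAt_smul]
  have hw : wordDeriv (w ∘ σ) (invDeriv (w i) Q) =
      wordDeriv (w ∘ (Fin.snoc σ i : Fin (j + 1) → Fin d)) Q := by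
    rw [← wordDeriv_snoc]
    congr 1
    funext l
    refine Fin.lastCases ?_ (fun l' => ?_) l
    · simp [Fin.snoc_last]
    · simp [Fin.snoc_castSucc]
  rw [hw, hQ (j + 1) (by omega) (Fin.snoc σ i), mul_zero]

/-- All words with letters in `span(w)` kill `Q` at `g`, given that all index-words in `w` of the
right lengths do. [folklore] -/
theorem eval_wordDeriv_eq_zero_of_indexWords {d : ℕ} (w : Fin d → ℂ × (Fin m → ℂ)) (g : GaGm m) :
    ∀ (k : ℕ) (u : Fin k → ℂ × (Fin m → ℂ)), (∀ i, u i ∈ Submodule.span ℂ (Set.range w)) →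
      ∀ (Q : MvPolynomial (Fin (m + 1)) ℂ) (R : ℕ),
        (∀ j < R + 1 + k, ∀ σ : Fin j → Fin d, evalAt (wordDeriv (w ∘ σ) Q) g = 0) →
        evalAt (wordDeriv u Q) g = 0 := by
  intro k
  induction k with
  | zero =>
    intro u _ Q R hQ
    have h := hQ 0 (by omega) Fin.elim0
    simpa using h
  | succ k ih =>
    intro u hu Q R hQ
    rw [wordDeriv_succ]
    refine ih (Fin.init u) (fun i => hu _) (invDeriv (u (Fin.last k)) Q) R ?_
    intro j hj σ
    exact indexWords_invDeriv w Q g (R + k + 1)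
      (fun j' hj' σ' => hQ j' (by omega) σ') (hu _) j (by omega) σ

/-- **Index-words in a spanning family control the order of vanishing.** If `W ⊆ span(w₀, …, w_{d-1})`
and every index-word `D_{w_{σ(0)}} ⋯ D_{w_{σ(k-1)}}`, `k < N`, kills `P` at `g`, then `P` vanishes to
order `≥ N` at `g` along `exp_G(W)` (multilinearity of words in their letters + the dictionary
`GaGm.vanishesToOrder_iff_wordDeriv`). [folklore] -/
theorem vanishesToOrder_of_indexWords {d : ℕ} (w : Fin d → ℂ × (Fin m → ℂ))
    (W : Submodule ℂ (ℂ × (Fin m → ℂ))) (hW : W ≤ Submodule.span ℂ (Set.range w))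
    (P : MvPolynomial (Fin (m + 1)) ℂ) (g : GaGm m) (N : ℕ)
    (h : ∀ k < N, ∀ σ : Fin k → Fin d, evalAt (wordDeriv (w ∘ σ) P) g = 0) :
    VanishesToOrder P W g N := by
  rw [vanishesToOrder_iff_wordDeriv]
  intro k hk u hu
  refine eval_wordDeriv_eq_zero_of_indexWords w g k u (fun i => hW (hu i)) P (N - k - 1) ?_
  intro j hj σ
  exact h j (by omega) σ

/-- Conversely, words in letters FROM `W` are among the words the dictionary controls. [folklore] -/
theorem indexWords_of_vanishesToOrder {d : ℕ} (w : Fin d → ℂ × (Fin m → ℂ))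
    (W : Submodule ℂ (ℂ × (Fin m → ℂ))) (hw : ∀ i, w i ∈ W)
    (P : MvPolynomial (Fin (m + 1)) ℂ) (g : GaGm m) (N : ℕ) (h : VanishesToOrder P W g N) :
    ∀ k < N, ∀ σ : Fin k → Fin d, evalAt (wordDeriv (w ∘ σ) P) g = 0 :=
  fun k hk σ => (vanishesToOrder_iff_wordDeriv P W g N).mp h k hk (w ∘ σ) fun i => hw (σ i)

end Generic

/-! ## §B. The Baker–Wüstholz letters on `𝔾ₐ × 𝔾ₘ^m` with pivot coordinate `j₀`

The letters are `L 0 = e₀ = (1, 0)` (so `D_{e₀} = ∂/∂Y₀`) and, for `k : Fin m`,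
`L k.succ = (0, b_{j₀} e_k − b_k e_{j₀})` (so `D = b_{j₀} Y_k ∂_k − b_k Y_{j₀} ∂_{j₀}`, Nesterenko's `∂ₖ`
with the pivot `n ↦ j₀`; the letter `k = j₀` is the zero vector, harmless).  They are taken as a
variable `L` with defining hypotheses, so that no definition is introduced. -/

section Letters

variable {m : ℕ} (b : Fin m → ℂ) (j₀ : Fin m)
variable (L : Fin (m + 1) → ℂ × (Fin m → ℂ))

/-- Every `W` on which `∑ⱼ bⱼ ηⱼ = 0` lies in the span of the letters, provided `b_{j₀} ≠ 0`:
`(η₀, η) = η₀ e₀ + ∑ₖ (ηₖ / b_{j₀}) (b_{j₀} e_k − b_k e_{j₀})` (the `j₀`-coordinate uses `∑ bⱼηⱼ = 0`).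
[cite: Nesterenko2003, §5.2 (definition of 𝔚)] -/
theorem le_span_bwLetters (hb : b j₀ ≠ 0) (hL0 : L 0 = (1, 0))
    (hLs : ∀ k : Fin m, L k.succ = (0, Pi.single k (b j₀) - Pi.single j₀ (b k)))
    (W : Submodule ℂ (ℂ × (Fin m → ℂ))) (hWb : ∀ u ∈ W, ∑ j, b j * u.2 j = 0) :
    W ≤ Submodule.span ℂ (Set.range L) := by
  classical
  intro u hu
  have hsum := hWb u hu
  -- the explicit combination
  have hrepr : u = u.1 • L 0 + ∑ k : Fin m, (u.2 k / b j₀) • L k.succ := by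
    ext
    · simp [hL0, hLs, Prod.fst_sum]
    · rename_i j
      simp only [hL0, hLs, Prod.snd_add, Prod.smul_snd, smul_zero, zero_add, Finset.sum_apply,
        Pi.smul_apply, Pi.sub_apply, smul_eq_mul, Prod.snd_sum]
      simp only [Pi.single_apply, mul_sub, mul_ite, mul_zero, Finset.sum_sub_distrib,
        Finset.sum_ite_eq, Finset.mem_univ, if_true]
      by_cases hj : j = j₀
      · subst hj
        simp only [if_true]
        have : ∑ k : Fin m, u.2 k / b j * b k = (∑ k, b k * u.2 k) / b j := by
          rw [Finset.sum_div]; exact Finset.sum_congr rfl fun k _ => by ring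
        rw [this, hsum, zero_div, sub_zero, div_mul_cancel₀ _ hb]
      · simp only [hj, if_false, Finset.sum_const_zero, sub_zero]
        rw [div_mul_cancel₀ _ hb]
  rw [hrepr]
  refine Submodule.add_mem _ (Submodule.smul_mem _ _ (Submodule.subset_span ⟨0, rfl⟩))
    (Submodule.sum_mem _ fun k _ => Submodule.smul_mem _ _ (Submodule.subset_span ⟨k.succ, rfl⟩))

/-- `D_{e₀} = ∂/∂Y₀`. [folklore] -/
theorem invDeriv_e0 (P : MvPolynomial (Fin (m + 1)) ℂ) :
    invDeriv ((1 : ℂ), (0 : Fin m → ℂ)) P = pderiv 0 P := by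
  simp [invDeriv_apply]

/-- Euler's identity on a monomial: `Yᵢ ∂P/∂Yᵢ = sᵢ · Y^s` for `P = r Y^s`. [folklore] -/
theorem X_mul_pderiv_monomial (i : Fin (m + 1)) (s : Fin (m + 1) →₀ ℕ) (r : ℂ) :
    X i * pderiv i (monomial s r) = ((s i : ℕ) : ℂ) • monomial s r := by
  rw [pderiv_monomial]
  by_cases hsi : s i = 0
  · simp [hsi]
  · rw [X, monomial_mul, one_mul, MvPolynomial.smul_monomial]
    have hle : Finsupp.single i 1 ≤ s := by
      rw [Finsupp.single_le_iff]; omega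
    rw [add_tsub_cancel_of_le hle, smul_eq_mul, mul_comm]

/-- A torus letter `(0, v)` acts on a monomial by the scalar `∑ⱼ vⱼ s_{j+1}`:
`D_{(0,v)} (r Y^s) = (∑ⱼ vⱼ sⱼ₊₁) · r Y^s`. [folklore] -/
theorem invDeriv_torus_monomial (v : Fin m → ℂ) (s : Fin (m + 1) →₀ ℕ) (r : ℂ) :
    invDeriv ((0 : ℂ), v) (monomial s r) = (∑ j, v j * ((s j.succ : ℕ) : ℂ)) • monomial s r := by
  rw [invDeriv_apply]
  show (0 : ℂ) • pderiv 0 (monomial s r) + ∑ j, v j • (X j.succ * pderiv j.succ (monomial s r)) = _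
  rw [zero_smul, zero_add, Finset.sum_smul]
  refine Finset.sum_congr rfl fun j _ => ?_
  rw [X_mul_pderiv_monomial, smul_smul]

/-- The scalar of the letter `k.succ` on `Y^s`: `b_{j₀} s_{k+1} − b_k s_{j₀+1}` (Nesterenko's
`𝔛ₖ(s) = bₙ sₖ − bₖ sₙ`). [cite: Nesterenko2003, §3.5 p. 72] -/
theorem invDeriv_bwLetter_monomial
    (hLs : ∀ k : Fin m, L k.succ = (0, Pi.single k (b j₀) - Pi.single j₀ (b k)))
    (k : Fin m) (s : Fin (m + 1) →₀ ℕ) (r : ℂ) :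
    invDeriv (L k.succ) (monomial s r) =
      (b j₀ * ((s k.succ : ℕ) : ℂ) - b k * ((s j₀.succ : ℕ) : ℂ)) • monomial s r := by
  classical
  rw [hLs, invDeriv_torus_monomial]
  congr 1
  simp only [Pi.sub_apply, Pi.single_apply, sub_mul, Finset.sum_sub_distrib, ite_mul, zero_mul,
    Finset.sum_ite_eq', Finset.mem_univ, if_true]

/-- Iterated `∂/∂Y₀` on a monomial: `∂₀^z (r Y^s) = r · s₀(s₀−1)⋯(s₀−z+1) · Y^{s − z e₀}`. [folklore] -/
theorem iterate_pderiv_zero_monomial (z : ℕ) (s : Fin (m + 1) →₀ ℕ) (r : ℂ) :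
    (pderiv 0)^[z] (monomial s r) =
      monomial (s - Finsupp.single 0 z) (r * ((s 0).descFactorial z : ℕ)) := by
  induction z with
  | zero => simp
  | succ z ih =>
    rw [Function.iterate_succ_apply', ih, pderiv_monomial, Nat.descFactorial_succ]
    have h1 : s - Finsupp.single 0 z - Finsupp.single 0 1 = s - Finsupp.single (0 : Fin (m + 1)) (z + 1) := by
      ext i
      simp only [Finsupp.coe_tsub, Pi.sub_apply, Finsupp.single_apply]
      split_ifs <;> omega
    have h2 : r * (((s 0).descFactorial z : ℕ) : ℂ) *
        (((s - Finsupp.single (0 : Fin (m + 1)) z) (0 : Fin (m + 1)) : ℕ) : ℂ) =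
        r * (((s 0 - z) * (s 0).descFactorial z : ℕ) : ℂ) := by
      simp only [Finsupp.coe_tsub, Pi.sub_apply, Finsupp.single_eq_same]
      push_cast
      ring
    rw [h1, h2]

/-- The scalar attached to a letter index on the monomial `Y^s`: `1` for the letter `e₀`,
`b_{j₀} s_{k+1} − b_k s_{j₀+1}` for the letter `k.succ`; written with `Fin.cases`. CLOSED FORM of an
index-word on a monomial: the torus letters contribute their scalars, the `e₀` letters
differentiate in `Y₀`. [cite: Nesterenko2003, §3.5 p. 72] -/
theorem wordDeriv_bwLetters_monomial (hL0 : L 0 = (1, 0))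
    (hLs : ∀ k : Fin m, L k.succ = (0, Pi.single k (b j₀) - Pi.single j₀ (b k))) :
    ∀ (k : ℕ) (σ : Fin k → Fin (m + 1)) (s : Fin (m + 1) →₀ ℕ) (r : ℂ),
      wordDeriv (L ∘ σ) (monomial s r) =
        (∏ i, Fin.cases (motive := fun _ => ℂ) 1
            (fun k' => b j₀ * ((s k'.succ : ℕ) : ℂ) - b k' * ((s j₀.succ : ℕ) : ℂ)) (σ i)) •
          (pderiv 0)^[(Finset.univ.filter fun i => σ i = 0).card] (monomial s r) := by
  classical
  intro k
  induction k with
  | zero =>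
    intro σ s r
    simp
  | succ k ih =>
    intro σ s r
    rw [wordDeriv_succ]
    -- split on the last letter
    have hcard : (Finset.univ.filter fun i : Fin (k + 1) => σ i = 0).card =
        (Finset.univ.filter fun i : Fin k => σ (Fin.castSucc i) = 0).card +
          (if σ (Fin.last k) = 0 then 1 else 0) := by
      rw [Finset.card_filter, Finset.card_filter, Fin.sum_univ_castSucc]
    have hprod : (∏ i : Fin (k + 1), Fin.cases (motive := fun _ => ℂ) 1
            (fun k' => b j₀ * ((s k'.succ : ℕ) : ℂ) - b k' * ((s j₀.succ : ℕ) : ℂ)) (σ i)) =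
        (∏ i : Fin k, Fin.cases (motive := fun _ => ℂ) 1
            (fun k' => b j₀ * ((s k'.succ : ℕ) : ℂ) - b k' * ((s j₀.succ : ℕ) : ℂ)) (σ (Fin.castSucc i))) *
          Fin.cases (motive := fun _ => ℂ) 1
            (fun k' => b j₀ * ((s k'.succ : ℕ) : ℂ) - b k' * ((s j₀.succ : ℕ) : ℂ)) (σ (Fin.last k)) :=
      Fin.prod_univ_castSucc _
    rcases Fin.eq_zero_or_eq_succ (σ (Fin.last k)) with h0 | ⟨k', hk'⟩
    · -- last letter `e₀`: differentiate once, exponents at `succ` unchanged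
      have hD : invDeriv ((L ∘ σ) (Fin.last k)) (monomial s r) =
          monomial (s - Finsupp.single 0 1) (r * ((s 0 : ℕ) : ℂ)) := by
        simp only [Function.comp_apply, h0, hL0, invDeriv_e0, pderiv_monomial]
      rw [hD]
      have hinit : (L ∘ σ) ∘ Fin.castSucc = L ∘ (fun i : Fin k => σ (Fin.castSucc i)) := rfl
      rw [show Fin.init (L ∘ σ) = L ∘ (fun i : Fin k => σ (Fin.castSucc i)) from rfl,
        ih (fun i => σ (Fin.castSucc i)) (s - Finsupp.single 0 1) (r * ((s 0 : ℕ) : ℂ))]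
      rw [hcard, hprod, h0, if_pos rfl]
      simp only [Fin.cases_zero, mul_one, Finsupp.tsub_apply, Finsupp.single_apply]
      congr 1
      rw [Function.iterate_succ_apply, pderiv_monomial]
    · -- last letter a torus letter: a scalar
      have hD : invDeriv ((L ∘ σ) (Fin.last k)) (monomial s r) =
          (b j₀ * ((s k'.succ : ℕ) : ℂ) - b k' * ((s j₀.succ : ℕ) : ℂ)) • monomial s r := by
        simp only [Function.comp_apply, hk']
        exact invDeriv_bwLetter_monomial b j₀ L hLs k' s r
      rw [hD, wordDeriv_smul,
        show Fin.init (L ∘ σ) = L ∘ (fun i : Fin k => σ (Fin.castSucc i)) from rfl,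
        ih (fun i => σ (Fin.castSucc i)) s r, smul_smul, hcard, hprod, hk']
      simp only [Fin.cases_succ, Fin.succ_ne_zero, if_false, add_zero]
      ring_nf

end Letters

end Summit.ABC.StewartYu.GenThreeVanishing

end
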